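import Summits.QuantumFields.YangMills.Theorems.BalabanUVNodesSpineReadingOfRecord13CoPHKComponentSizeBlocks

/-!
# THE BLOCK-GRAIN ASSEMBLY READ WITH THE PHYSICAL EVENT «the animal's blocks lie INSIDE the large-field region»: the keys of record are block-saturated
# (`Node00.blockSaturated_seq_Λ_compl`), so at the identity key reading — and at any reading that keeps saturation — the INSIDE block energy letters give the N20 face

Cell `pub-ymgap`, YM-PLAN Track A (HUMAN RULING D-0062; width push D-0149); seat `pub-ymgap-dag-n20-d` (R134 (a) N20 NE7b s3 = the U5d ∕ `crOfRecord₁₃` lineage, its declarer)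
gen 33; companion of `…CoPHKComponentSizeBlocks` (gen 33: `relWeightBound_card_of_blockEnergyLetters_geometric`, event «`↑A ⊆ iterBlockOf lv '' Z_j`» = every block MEETS
`Z_j`) and `Node00/TwoRunSiteBlockAnimals` (gen 33: `iterBlock_subset_of_mem_image`, `blockSaturated_seq_Λ_compl`, `pow_dvd_dCubeSide_of_le`).
`--kind proof --supports stmt-QuantumFields-27366 --as helper` (K3⁸); COUNT-NEUTRAL; THEOREMS ONLY (0 `def`).  [III] = [Balaban1988Convergent].
WHY.  The energy of a large-field history is paid per cube INSIDE the region, so the block energy letter a supplier can hope to inhabit reads «the coarse classes whose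
level-`j` region CONTAINS the `n` blocks of the animal weigh `≤ δ^n` of the total».  `…ComponentSizeBlocks` states its letters with the weaker event «every block MEETS the
region» (no geometry needed there).  For the keys of record the two events coincide: every entry `Λ_j` of an admissible sequence over `Node00.DOfRecord` is a union of
`𝐃_j`-cubes of `L^j · M · R_j` finest sites per side, hence `lv`-block-saturated whenever `L^{lv} ∣ L^j · M · R_j` — always for `lv ≤ j` ([III] (2.1) p. 254;
`Node00.blockSaturated_seq_Λ_compl`).  This file (§1) proves the saturation of the class set of record at step `K` (run A's keys `seqKey s`, run B's keys `seqKey (truncShift s')`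
or the total key's junk `∅`), (§2) shows that under saturation the MEETS-event class lies inside the INSIDE-event class, so an INSIDE letter implies the MEETS letter, and (§3)
restates the gen-33 face with INSIDE letters: ★★★ `relWeightBound_card_of_insideBlockEnergyLetters_geometric` (any step-preserving reading that keeps saturation — hypothesis
shape `hsat`), ★★★ `relWeightBound_card_of_insideBlockEnergyLetters_id_of_dvd` (the identity reading `keyReadingId₁₃`, block levels as coarse as the divisibilities
`L^{lv K j} ∣ L^j · M · R_j` of the two runs allow — up to the `𝐃_j`-cubes themselves), ★★★ `…_id_of_eq` (the 𝐃-CUBE GRAIN: `L^{lv K j} = L^j · M · R_j` for both runs —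
the letter pays per whole `𝐃_j`-cube, print's grain) and ★★★ `relWeightBound_card_of_insideBlockEnergyLetters_id` (`lv K j ≤ j`: NO saturation hypothesis left).
HONEST FRAMING.  [folklore] bookkeeping BY NAME over gen-33's geometry; the INSIDE block energy letters are HYPOTHESES (inhabited for no family today; NOT PRINTED as two-run
statements; LCS-shaped); at `lv ≤ j` the blocks are no coarser than the level-`j` lattice blocks, finer than the `𝐃_j`-cubes by the factor `M · R_j` per side — the regime in
which a supplier must still win `(M R_j)^4` blocks per cube (numeric side condition on `p₀` vs `r`, not checked here); coarser levels need `L^{lv−j} ∣ M · R_j` (carried as the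
divisibility hypotheses of `blockSaturated_of_mem_classSet₁₃`).  NO weight is bounded, NO estimate proved; nothing of Bałaban's asserted; NE7 ∕ NE7b ∕ NE7c NOT PRINTED for
`d = 4` ∕ NOT proved; no `Provisos₁₃CoPH` inhabitant claimed (K0⁷ OPEN); K3⁸ v7 untouched; N19 ∕ N20 ∕ N21 ∕ N27 NOT discharged; counts UNMOVED (typed 28∕28 · discharged 8∕27);
one finite four-torus programme at fixed `ε` — NOT ℝ⁴, NOT OS, NOT a mass gap, NOT the Clay problem.  No `def`, no `instance`, no `notation`, no `sorry`; no cite tags below.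
-/

noncomputable section

open scoped BigOperators
open Finset

namespace YMDAG.UVSplit

open Literature.MathematicalPhysics.QuantumFieldTheory.Balaban1983to89
open Literature.MathematicalPhysics.QuantumFieldTheory.Balaban1983to89.T4Continuum
open Literature.MathematicalPhysics.QuantumFieldTheory.Balaban1983to89.Node00
open Literature.MathematicalPhysics.QuantumFieldTheory.Balaban1983to89.B5Eq118OneStroke (iterBlockOf iterBlock)
open T4WeightBudget (RelWeightBound)
open Summit.QuantumFields.YangMills.BalabanUVNodes.N21KeyedShellWeightShellZero (weightA₁₃_nonneg weightB₁₃_nonneg)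

variable {F : T4Family} {N : ℕ} [NeZero N]

/-! ## §1 The keys of record are block-saturated -/

section Saturation

variable (θ : Stage13HParams F N) (K₀ : ℕ) (g₀ : ℕ → ℝ)

/-- ★ **THE LARGE-FIELD REGIONS OF THE CLASSES OF RECORD ARE `ℓ`-BLOCK-SATURATED** whenever `L^ℓ` divides both runs' level-`j` cube sides (run A's history at level `j`, run B's
at level `j + 1` — node U5d's flow-free truncation reads run B one level up): for every class `⟨K, y⟩` of record at step `K`, with a finest site `Z_j(y) = (y.2 j)ᶜ` contains every
finest site with the same `ℓ`-fold block point. [bookkeeping] -/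
theorem blockSaturated_of_mem_classSet₁₃ (K : ℕ) {ℓ j : ℕ} (hℓ : ℓ ≤ F.m + (K₀ + K))
    (hdvA : F.L ^ ℓ ∣ dCubeSide F.L θ.τ9.M (RkOfRecord F.L θ.ν.r (histA₁₃ θ K₀ g₀ K j)) j)
    (hdvB : F.L ^ ℓ ∣ dCubeSide F.L θ.τ9.M (RkOfRecord F.L θ.ν.r (histB₁₃ θ K₀ g₀ K (j + 1))) j)
    {y : SiteSeqKey F (K₀ + K)} (hy : (⟨K, y⟩ : Σ K, SiteSeqKey F (K₀ + K)) ∈ classSet₁₃ θ K₀ g₀ K) :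
    ∀ ⦃x x' : Site (F.P (K₀ + K)) 0⦄, iterBlockOf ℓ x = iterBlockOf ℓ x' → x ∈ (y.2 j)ᶜ → x' ∈ (y.2 j)ᶜ := by
  letI : ∀ Kc, DecidableEq (SiteSeqKey F Kc) := fun _ => Classical.decEq _
  unfold classSet₁₃ at hy
  rcases Finset.mem_union.mp hy with h | h
  · obtain ⟨s, -, hs⟩ := Finset.mem_image.mp h
    have hys : y = seqKey s := (eq_of_heq (Sigma.mk.inj hs).2).symm
    rw [hys, seqKey_snd]
    exact blockSaturated_seq_Λ_compl F θ.ν θ.τ9.M (histA₁₃ θ K₀ g₀ K) (K₀ + K) (K₀ + K) s hℓ hdvA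
  · obtain ⟨s', -, hs'⟩ := Finset.mem_image.mp h
    unfold keyB₁₃ at hs'
    split_ifs at hs' with hM
    · have hys : y = seqKey (truncShift F θ.ν hM (histB₁₃ θ K₀ g₀ K) s') := (eq_of_heq (Sigma.mk.inj hs').2).symm
      rw [hys, seqKey_snd]
      exact blockSaturated_seq_Λ_compl F θ.ν θ.τ9.M (fun j => histB₁₃ θ K₀ g₀ K (j + 1)) (K₀ + K) (K₀ + K) _ hℓ hdvB
    · have hys : y = (fun _ => ∅, fun _ => ∅) := (eq_of_heq (Sigma.mk.inj hs').2).symm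
      intro x x' _ _
      rw [hys]
      simp

/-- … in particular for every `ℓ ≤ j`, with NO divisibility hypothesis (`Node00.pow_dvd_dCubeSide_of_le`). [bookkeeping] -/
theorem blockSaturated_of_mem_classSet₁₃_of_le (K : ℕ) {ℓ j : ℕ} (hℓj : ℓ ≤ j) (hℓ : ℓ ≤ F.m + (K₀ + K))
    {y : SiteSeqKey F (K₀ + K)} (hy : (⟨K, y⟩ : Σ K, SiteSeqKey F (K₀ + K)) ∈ classSet₁₃ θ K₀ g₀ K) :
    ∀ ⦃x x' : Site (F.P (K₀ + K)) 0⦄, iterBlockOf ℓ x = iterBlockOf ℓ x' → x ∈ (y.2 j)ᶜ → x' ∈ (y.2 j)ᶜ :=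
  blockSaturated_of_mem_classSet₁₃ θ K₀ g₀ K hℓ (pow_dvd_dCubeSide_of_le _ _ _ hℓj) (pow_dvd_dCubeSide_of_le _ _ _ hℓj) hy

/-- **AT THE IDENTITY KEY READING THE COARSE CLASS SET IS THE CLASS SET OF RECORD**, so its keys are `lv K j`-block-saturated whenever `L^{lv K j}` divides both runs'
level-`j` cube sides — the saturation hypothesis shape `hsat` of §3 DISCHARGED at `kr := keyReadingId₁₃` modulo the two divisibilities (coarse block levels, e.g.
`L^{lv K j} = L^j · M · R_j` = the `𝐃_j`-cube itself when `M`, `R_j` are powers of `L`). [bookkeeping] -/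
theorem hsat_keyReadingId₁₃_of_dvd (lv : ℕ → ℕ → ℕ) (hlv : ∀ K j, lv K j ≤ F.m + (K₀ + K)) (K j : ℕ)
    (hdvA : F.L ^ lv K j ∣ dCubeSide F.L θ.τ9.M (RkOfRecord F.L θ.ν.r (histA₁₃ θ K₀ g₀ K j)) j)
    (hdvB : F.L ^ lv K j ∣ dCubeSide F.L θ.τ9.M (RkOfRecord F.L θ.ν.r (histB₁₃ θ K₀ g₀ K (j + 1))) j) :
    ∀ u ∈ classSetK₁₃ θ K₀ g₀ (fun _ x => x) K, ∀ y : SiteSeqKey F (K₀ + K), u = ⟨K, y⟩ →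
      ∀ ⦃x x' : Site (F.P (K₀ + K)) 0⦄, iterBlockOf (lv K j) x = iterBlockOf (lv K j) x' → x ∈ (y.2 j)ᶜ → x' ∈ (y.2 j)ᶜ := by
  intro u hu y hy
  rw [classSetK₁₃_id] at hu
  subst hy
  exact blockSaturated_of_mem_classSet₁₃ θ K₀ g₀ K (hlv K j) hdvA hdvB hu

/-- … and for block levels `lv K j ≤ j` with NO divisibility hypothesis. [bookkeeping] -/
theorem hsat_keyReadingId₁₃ (lv : ℕ → ℕ → ℕ) (hlv : ∀ K j, lv K j ≤ F.m + (K₀ + K)) (K j : ℕ) (hlvj : lv K j ≤ j) :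
    ∀ u ∈ classSetK₁₃ θ K₀ g₀ (fun _ x => x) K, ∀ y : SiteSeqKey F (K₀ + K), u = ⟨K, y⟩ →
      ∀ ⦃x x' : Site (F.P (K₀ + K)) 0⦄, iterBlockOf (lv K j) x = iterBlockOf (lv K j) x' → x ∈ (y.2 j)ᶜ → x' ∈ (y.2 j)ᶜ := by
  intro u hu y hy
  rw [classSetK₁₃_id] at hu
  subst hy
  exact blockSaturated_of_mem_classSet₁₃_of_le θ K₀ g₀ K hlvj (hlv K j) hu

end Saturation

/-! ## §2 Under saturation the MEETS-event class lies inside the INSIDE-event class, so INSIDE letters give MEETS letters -/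

section Events

variable (θ : Stage13HParams F N) (hP : θ.Provisos₁₃CoPH F N) (K₀ : ℕ) (g₀ : ℕ → ℝ) (os : List (ULoop F))
  (kr : ℕ → (Σ K, SiteSeqKey F (K₀ + K)) → (Σ K, SiteSeqKey F (K₀ + K))) (lv : ℕ → ℕ → ℕ)

/-- **MEETS ⊆ INSIDE under saturation**: if every coarse class's level-`j` region is `lv K j`-block-saturated (hypothesis shape `hsat`), a class in the event «`↑A ⊆` block image
of `Z_j`» is in the event «every block of `A` lies inside `Z_j`» (`Node00.iterBlock_subset_of_mem_image`). [bookkeeping] -/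
theorem bad_meets_subset_bad_inside (K : ℕ) (t : ℝ) {j : ℕ}
    (hsat : ∀ u ∈ classSetK₁₃ θ K₀ g₀ kr K, ∀ y : SiteSeqKey F (K₀ + K), u = ⟨K, y⟩ →
      ∀ ⦃x x' : Site (F.P (K₀ + K)) 0⦄, iterBlockOf (lv K j) x = iterBlockOf (lv K j) x' → x ∈ (y.2 j)ᶜ → x' ∈ (y.2 j)ᶜ)
    (A : Finset (Site (F.P (K₀ + K)) (lv K j))) :
    badClassK₁₃ θ K₀ g₀ kr (fun _ u => ∀ y : SiteSeqKey F (K₀ + K), u = ⟨K, y⟩ →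
        (↑A : Set (Site (F.P (K₀ + K)) (lv K j))) ⊆ iterBlockOf (lv K j) '' (y.2 j)ᶜ) K t ⊆
      badClassK₁₃ θ K₀ g₀ kr (fun _ u => ∀ y : SiteSeqKey F (K₀ + K), u = ⟨K, y⟩ →
        ∀ b ∈ A, (↑(iterBlock (lv K j) b) : Set (Site (F.P (K₀ + K)) 0)) ⊆ (y.2 j)ᶜ) K t := by
  intro u hu
  obtain ⟨huS, hev⟩ := (mem_badClassK₁₃_iff θ K₀ g₀ kr _ K t u).1 hu
  refine (mem_badClassK₁₃_iff θ K₀ g₀ kr _ K t u).2 ⟨huS, fun y hy b hb => ?_⟩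
  exact iterBlock_subset_of_mem_image (hsat u huS y hy) (hev y hy (Finset.mem_coe.2 hb))

/-- **AN INSIDE LETTER GIVES THE MEETS LETTER** for a non-negative weight under saturation (monotonicity of the class sum along `bad_meets_subset_bad_inside`). [bookkeeping] -/
theorem meetsLetter_of_insideLetter (K : ℕ) (t : ℝ) {j : ℕ}
    (hsat : ∀ u ∈ classSetK₁₃ θ K₀ g₀ kr K, ∀ y : SiteSeqKey F (K₀ + K), u = ⟨K, y⟩ →
      ∀ ⦃x x' : Site (F.P (K₀ + K)) 0⦄, iterBlockOf (lv K j) x = iterBlockOf (lv K j) x' → x ∈ (y.2 j)ᶜ → x' ∈ (y.2 j)ᶜ)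
    (f : (Σ K, SiteSeqKey F (K₀ + K)) → ℝ) (hf : ∀ u ∈ classSetK₁₃ θ K₀ g₀ kr K, 0 ≤ f u) {c : ℝ} (A : Finset (Site (F.P (K₀ + K)) (lv K j)))
    (hin : ∑ u ∈ badClassK₁₃ θ K₀ g₀ kr (fun _ u => ∀ y : SiteSeqKey F (K₀ + K), u = ⟨K, y⟩ →
        ∀ b ∈ A, (↑(iterBlock (lv K j) b) : Set (Site (F.P (K₀ + K)) 0)) ⊆ (y.2 j)ᶜ) K t, f u ≤ c) :
    ∑ u ∈ badClassK₁₃ θ K₀ g₀ kr (fun _ u => ∀ y : SiteSeqKey F (K₀ + K), u = ⟨K, y⟩ →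
        (↑A : Set (Site (F.P (K₀ + K)) (lv K j))) ⊆ iterBlockOf (lv K j) '' (y.2 j)ᶜ) K t, f u ≤ c :=
  (Finset.sum_le_sum_of_subset_of_nonneg (bad_meets_subset_bad_inside θ K₀ g₀ kr lv K t hsat A)
    (fun u hu _ => hf u (badClassK₁₃_subset θ K₀ g₀ kr _ K t hu))).trans hin

end Events

/-! ## §3 The face from INSIDE block energy letters -/

section Face

variable (θ : Stage13HParams F N) (hP : θ.Provisos₁₃CoPH F N) (K₀ : ℕ) (g₀ : ℕ → ℝ) (os : List (ULoop F))
  (kr : ℕ → (Σ K, SiteSeqKey F (K₀ + K)) → (Σ K, SiteSeqKey F (K₀ + K))) (jcut : ℕ → ℕ) (n lv : ℕ → ℕ → ℕ)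

/-- ★★★ **THE N20 FACE AT THE BLOCK-GRAIN DIAL FROM INSIDE BLOCK ENERGY LETTERS** (any step-preserving key reading whose coarse classes keep their level-`j` regions
`lv K j`-block-saturated for `1 ≤ j ≤ jcut K` — hypothesis shape `hsat`, discharged at the identity reading below): uniformly small INSIDE letters (`0 ≤ δ K j ≤ δ₀`,
`2·(3^4 − 1)²·δ₀ ≤ 1`) in both runs under the threshold schedule `n K j ≥ ⌈log₂ |Site_{lv K j}|⌉ + K + j + 3` give `RelWeightBound` at the coarse carriers with the geometric weight
`W K := δ₀ · 2^{−(K+1)}`. [bookkeeping] -/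
theorem relWeightBound_card_of_insideBlockEnergyLetters_geometric
    (hkr : ∀ (K : ℕ) (x : Σ K, SiteSeqKey F (K₀ + K)), x ∈ classSet₁₃ θ K₀ g₀ K → (kr K x).1 = K)
    {δ : ℕ → ℕ → ℝ} {δ₀ : ℝ} (hδ0 : ∀ K j, 0 ≤ δ K j) (hδ1 : ∀ K j, δ K j ≤ δ₀) (hD : 2 * ((3 : ℝ) ^ 4 - 1) ^ 2 * δ₀ ≤ 1)
    (hn : ∀ K j, Nat.clog 2 (Fintype.card (Site (F.P (K₀ + K)) (lv K j))) + K + j + 3 ≤ n K j) (hlv : ∀ K j, lv K j ≤ F.m + (K₀ + K))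
    (hsat : ∀ K, ∀ j ∈ Finset.Icc 1 (jcut K), ∀ u ∈ classSetK₁₃ θ K₀ g₀ kr K, ∀ y : SiteSeqKey F (K₀ + K), u = ⟨K, y⟩ →
      ∀ ⦃x x' : Site (F.P (K₀ + K)) 0⦄, iterBlockOf (lv K j) x = iterBlockOf (lv K j) x' → x ∈ (y.2 j)ᶜ → x' ∈ (y.2 j)ᶜ)
    (hEA : ∀ (K : ℕ) (t : ℝ), |t| ≤ 1 → ∀ j ∈ Finset.Icc 1 (jcut K), ∀ p ∈ animalCoverFamily (SiteTouch (P := F.P (K₀ + K)) (j := lv K j)) (n K j),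
      ∑ u ∈ badClassK₁₃ θ K₀ g₀ kr (fun _ u => ∀ y : SiteSeqKey F (K₀ + K), u = ⟨K, y⟩ →
          ∀ b ∈ p.2, (↑(iterBlock (lv K j) b) : Set (Site (F.P (K₀ + K)) 0)) ⊆ (y.2 j)ᶜ) K t,
          weightAK₁₃ θ hP K₀ g₀ os kr K t u ≤ δ K j ^ n K j * ∑ u ∈ classSetK₁₃ θ K₀ g₀ kr K, weightAK₁₃ θ hP K₀ g₀ os kr K t u)
    (hEB : ∀ (K : ℕ) (t : ℝ), |t| ≤ 1 → ∀ j ∈ Finset.Icc 1 (jcut K), ∀ p ∈ animalCoverFamily (SiteTouch (P := F.P (K₀ + K)) (j := lv K j)) (n K j),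
      ∑ u ∈ badClassK₁₃ θ K₀ g₀ kr (fun _ u => ∀ y : SiteSeqKey F (K₀ + K), u = ⟨K, y⟩ →
          ∀ b ∈ p.2, (↑(iterBlock (lv K j) b) : Set (Site (F.P (K₀ + K)) 0)) ⊆ (y.2 j)ᶜ) K t,
          weightBK₁₃ θ hP K₀ g₀ os kr K t u ≤ δ K j ^ n K j * ∑ u ∈ classSetK₁₃ θ K₀ g₀ kr K, weightBK₁₃ θ hP K₀ g₀ os kr K t u) :
    RelWeightBound 1 (classSetK₁₃ θ K₀ g₀ kr) (weightAK₁₃ θ hP K₀ g₀ os kr) (weightBK₁₃ θ hP K₀ g₀ os kr)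
      (badClassK₁₃ θ K₀ g₀ kr (badKeyReadingOfBigComponent₁₃ N K₀ jcut (bigDialOfCard₁₃ K₀ (fun K j => n K j * (F.L ^ 4) ^ lv K j)) F θ hP g₀ os))
      (fun K => δ₀ * (1 / 2) ^ (K + 1)) :=
  relWeightBound_card_of_blockEnergyLetters_geometric θ hP K₀ g₀ os kr jcut n lv hkr hδ0 hδ1 hD hn hlv
    (fun K t ht j hj p hp => meetsLetter_of_insideLetter θ K₀ g₀ kr lv K t (hsat K j hj) _
      (fun u _ => weightAK₁₃_nonneg θ hP K₀ g₀ os kr (fun x _ => weightA₁₃_nonneg F θ hP K₀ g₀ os K t x) u) p.2 (hEA K t ht j hj p hp))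
    (fun K t ht j hj p hp => meetsLetter_of_insideLetter θ K₀ g₀ kr lv K t (hsat K j hj) _
      (fun u _ => weightBK₁₃_nonneg θ hP K₀ g₀ os kr (fun x _ => weightB₁₃_nonneg F θ hP K₀ g₀ os K t x) u) p.2 (hEB K t ht j hj p hp))

/-- ★★★ **… AT THE IDENTITY KEY READING `keyReadingId₁₃`, ANY BLOCK LEVELS whose `L^{lv K j}` divides both runs' level-`j` cube sides** (`1 ≤ j ≤ jcut K`) — the COARSE-BLOCK
form (blocks as coarse as the `𝐃_j`-cubes themselves when `M · R_j` is a power of `L`): INSIDE block energy letters at the classes of record, uniformly small, under the threshold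
schedule, give `RelWeightBound` at the record's carriers with the geometric weight `δ₀ · 2^{−(K+1)}`. [bookkeeping] -/
theorem relWeightBound_card_of_insideBlockEnergyLetters_id_of_dvd
    {δ : ℕ → ℕ → ℝ} {δ₀ : ℝ} (hδ0 : ∀ K j, 0 ≤ δ K j) (hδ1 : ∀ K j, δ K j ≤ δ₀) (hD : 2 * ((3 : ℝ) ^ 4 - 1) ^ 2 * δ₀ ≤ 1)
    (hn : ∀ K j, Nat.clog 2 (Fintype.card (Site (F.P (K₀ + K)) (lv K j))) + K + j + 3 ≤ n K j) (hlv : ∀ K j, lv K j ≤ F.m + (K₀ + K))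
    (hdvA : ∀ K, ∀ j ∈ Finset.Icc 1 (jcut K), F.L ^ lv K j ∣ dCubeSide F.L θ.τ9.M (RkOfRecord F.L θ.ν.r (histA₁₃ θ K₀ g₀ K j)) j)
    (hdvB : ∀ K, ∀ j ∈ Finset.Icc 1 (jcut K), F.L ^ lv K j ∣ dCubeSide F.L θ.τ9.M (RkOfRecord F.L θ.ν.r (histB₁₃ θ K₀ g₀ K (j + 1))) j)
    (hEA : ∀ (K : ℕ) (t : ℝ), |t| ≤ 1 → ∀ j ∈ Finset.Icc 1 (jcut K), ∀ p ∈ animalCoverFamily (SiteTouch (P := F.P (K₀ + K)) (j := lv K j)) (n K j),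
      ∑ u ∈ badClassK₁₃ θ K₀ g₀ (fun _ x => x) (fun _ u => ∀ y : SiteSeqKey F (K₀ + K), u = ⟨K, y⟩ →
          ∀ b ∈ p.2, (↑(iterBlock (lv K j) b) : Set (Site (F.P (K₀ + K)) 0)) ⊆ (y.2 j)ᶜ) K t,
          weightAK₁₃ θ hP K₀ g₀ os (fun _ x => x) K t u ≤
        δ K j ^ n K j * ∑ u ∈ classSetK₁₃ θ K₀ g₀ (fun _ x => x) K, weightAK₁₃ θ hP K₀ g₀ os (fun _ x => x) K t u)
    (hEB : ∀ (K : ℕ) (t : ℝ), |t| ≤ 1 → ∀ j ∈ Finset.Icc 1 (jcut K), ∀ p ∈ animalCoverFamily (SiteTouch (P := F.P (K₀ + K)) (j := lv K j)) (n K j),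
      ∑ u ∈ badClassK₁₃ θ K₀ g₀ (fun _ x => x) (fun _ u => ∀ y : SiteSeqKey F (K₀ + K), u = ⟨K, y⟩ →
          ∀ b ∈ p.2, (↑(iterBlock (lv K j) b) : Set (Site (F.P (K₀ + K)) 0)) ⊆ (y.2 j)ᶜ) K t,
          weightBK₁₃ θ hP K₀ g₀ os (fun _ x => x) K t u ≤
        δ K j ^ n K j * ∑ u ∈ classSetK₁₃ θ K₀ g₀ (fun _ x => x) K, weightBK₁₃ θ hP K₀ g₀ os (fun _ x => x) K t u) :
    RelWeightBound 1 (classSetK₁₃ θ K₀ g₀ (keyReadingId₁₃ N K₀ F θ hP g₀ os)) (weightAK₁₃ θ hP K₀ g₀ os (keyReadingId₁₃ N K₀ F θ hP g₀ os))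
      (weightBK₁₃ θ hP K₀ g₀ os (keyReadingId₁₃ N K₀ F θ hP g₀ os))
      (badClassK₁₃ θ K₀ g₀ (keyReadingId₁₃ N K₀ F θ hP g₀ os)
        (badKeyReadingOfBigComponent₁₃ N K₀ jcut (bigDialOfCard₁₃ K₀ (fun K j => n K j * (F.L ^ 4) ^ lv K j)) F θ hP g₀ os))
      (fun K => δ₀ * (1 / 2) ^ (K + 1)) :=
  relWeightBound_card_of_insideBlockEnergyLetters_geometric θ hP K₀ g₀ os (fun _ x => x) jcut n lv (fun _ _ hx => fst_eq_of_mem_classSet₁₃ θ K₀ g₀ hx) hδ0 hδ1 hD hn hlv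
    (fun K j hj => hsat_keyReadingId₁₃_of_dvd θ K₀ g₀ lv hlv K j (hdvA K j hj) (hdvB K j hj)) hEA hEB

/-- ★★★ **… AT THE 𝐃-CUBE GRAIN**: when both runs' level-`j` cube sides `L^j · M · R_j` EQUAL `L^{lv K j}` (`1 ≤ j ≤ jcut K`; `M`, `R_j` powers of `L` and the two
histories' `R_j` agree — node U5d's `RAgree` regime), the blocks of level `lv K j` ARE the `𝐃_j`-cubes, and the INSIDE letter reads «the classes of record whose level-`j`
large-field region contains the `n K j` whole `𝐃_j`-CUBES of a connected cube animal weigh `≤ δ K j ^ (n K j)` of the total» — the grain at which print pays its large-field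
factors ([LF-II] (1.79) ∕ (1.89): one factor per large-field cube). [bookkeeping] -/
theorem relWeightBound_card_of_insideBlockEnergyLetters_id_of_eq
    {δ : ℕ → ℕ → ℝ} {δ₀ : ℝ} (hδ0 : ∀ K j, 0 ≤ δ K j) (hδ1 : ∀ K j, δ K j ≤ δ₀) (hD : 2 * ((3 : ℝ) ^ 4 - 1) ^ 2 * δ₀ ≤ 1)
    (hn : ∀ K j, Nat.clog 2 (Fintype.card (Site (F.P (K₀ + K)) (lv K j))) + K + j + 3 ≤ n K j) (hlv : ∀ K j, lv K j ≤ F.m + (K₀ + K))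
    (hsideA : ∀ K, ∀ j ∈ Finset.Icc 1 (jcut K), dCubeSide F.L θ.τ9.M (RkOfRecord F.L θ.ν.r (histA₁₃ θ K₀ g₀ K j)) j = F.L ^ lv K j)
    (hsideB : ∀ K, ∀ j ∈ Finset.Icc 1 (jcut K), dCubeSide F.L θ.τ9.M (RkOfRecord F.L θ.ν.r (histB₁₃ θ K₀ g₀ K (j + 1))) j = F.L ^ lv K j)
    (hEA : ∀ (K : ℕ) (t : ℝ), |t| ≤ 1 → ∀ j ∈ Finset.Icc 1 (jcut K), ∀ p ∈ animalCoverFamily (SiteTouch (P := F.P (K₀ + K)) (j := lv K j)) (n K j),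
      ∑ u ∈ badClassK₁₃ θ K₀ g₀ (fun _ x => x) (fun _ u => ∀ y : SiteSeqKey F (K₀ + K), u = ⟨K, y⟩ →
          ∀ b ∈ p.2, (↑(iterBlock (lv K j) b) : Set (Site (F.P (K₀ + K)) 0)) ⊆ (y.2 j)ᶜ) K t,
          weightAK₁₃ θ hP K₀ g₀ os (fun _ x => x) K t u ≤
        δ K j ^ n K j * ∑ u ∈ classSetK₁₃ θ K₀ g₀ (fun _ x => x) K, weightAK₁₃ θ hP K₀ g₀ os (fun _ x => x) K t u)
    (hEB : ∀ (K : ℕ) (t : ℝ), |t| ≤ 1 → ∀ j ∈ Finset.Icc 1 (jcut K), ∀ p ∈ animalCoverFamily (SiteTouch (P := F.P (K₀ + K)) (j := lv K j)) (n K j),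
      ∑ u ∈ badClassK₁₃ θ K₀ g₀ (fun _ x => x) (fun _ u => ∀ y : SiteSeqKey F (K₀ + K), u = ⟨K, y⟩ →
          ∀ b ∈ p.2, (↑(iterBlock (lv K j) b) : Set (Site (F.P (K₀ + K)) 0)) ⊆ (y.2 j)ᶜ) K t,
          weightBK₁₃ θ hP K₀ g₀ os (fun _ x => x) K t u ≤
        δ K j ^ n K j * ∑ u ∈ classSetK₁₃ θ K₀ g₀ (fun _ x => x) K, weightBK₁₃ θ hP K₀ g₀ os (fun _ x => x) K t u) :
    RelWeightBound 1 (classSetK₁₃ θ K₀ g₀ (keyReadingId₁₃ N K₀ F θ hP g₀ os)) (weightAK₁₃ θ hP K₀ g₀ os (keyReadingId₁₃ N K₀ F θ hP g₀ os))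
      (weightBK₁₃ θ hP K₀ g₀ os (keyReadingId₁₃ N K₀ F θ hP g₀ os))
      (badClassK₁₃ θ K₀ g₀ (keyReadingId₁₃ N K₀ F θ hP g₀ os)
        (badKeyReadingOfBigComponent₁₃ N K₀ jcut (bigDialOfCard₁₃ K₀ (fun K j => n K j * (F.L ^ 4) ^ lv K j)) F θ hP g₀ os))
      (fun K => δ₀ * (1 / 2) ^ (K + 1)) :=
  relWeightBound_card_of_insideBlockEnergyLetters_id_of_dvd θ hP K₀ g₀ os jcut n lv hδ0 hδ1 hD hn hlv
    (fun K j hj => (hsideA K j hj) ▸ dvd_rfl) (fun K j hj => (hsideB K j hj) ▸ dvd_rfl) hEA hEB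

/-- ★★★ **… AT THE IDENTITY KEY READING `keyReadingId₁₃`, BLOCK LEVELS `lv K j ≤ j`: NO SATURATION HYPOTHESIS LEFT** — the keys of record are unions of `𝐃_j`-cubes
(`blockSaturated_of_mem_classSet₁₃_of_le`), so INSIDE block energy letters at the classes of record, uniformly small, under the threshold schedule, give `RelWeightBound` at the
record's carriers with the component-size bad class of thresholds `n K j · L^{4·lv K j}` and the geometric weight `δ₀ · 2^{−(K+1)}`. [bookkeeping] -/
theorem relWeightBound_card_of_insideBlockEnergyLetters_id
    {δ : ℕ → ℕ → ℝ} {δ₀ : ℝ} (hδ0 : ∀ K j, 0 ≤ δ K j) (hδ1 : ∀ K j, δ K j ≤ δ₀) (hD : 2 * ((3 : ℝ) ^ 4 - 1) ^ 2 * δ₀ ≤ 1)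
    (hn : ∀ K j, Nat.clog 2 (Fintype.card (Site (F.P (K₀ + K)) (lv K j))) + K + j + 3 ≤ n K j) (hlv : ∀ K j, lv K j ≤ F.m + (K₀ + K))
    (hlvj : ∀ K, ∀ j ∈ Finset.Icc 1 (jcut K), lv K j ≤ j)
    (hEA : ∀ (K : ℕ) (t : ℝ), |t| ≤ 1 → ∀ j ∈ Finset.Icc 1 (jcut K), ∀ p ∈ animalCoverFamily (SiteTouch (P := F.P (K₀ + K)) (j := lv K j)) (n K j),
      ∑ u ∈ badClassK₁₃ θ K₀ g₀ (fun _ x => x) (fun _ u => ∀ y : SiteSeqKey F (K₀ + K), u = ⟨K, y⟩ →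
          ∀ b ∈ p.2, (↑(iterBlock (lv K j) b) : Set (Site (F.P (K₀ + K)) 0)) ⊆ (y.2 j)ᶜ) K t,
          weightAK₁₃ θ hP K₀ g₀ os (fun _ x => x) K t u ≤
        δ K j ^ n K j * ∑ u ∈ classSetK₁₃ θ K₀ g₀ (fun _ x => x) K, weightAK₁₃ θ hP K₀ g₀ os (fun _ x => x) K t u)
    (hEB : ∀ (K : ℕ) (t : ℝ), |t| ≤ 1 → ∀ j ∈ Finset.Icc 1 (jcut K), ∀ p ∈ animalCoverFamily (SiteTouch (P := F.P (K₀ + K)) (j := lv K j)) (n K j),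
      ∑ u ∈ badClassK₁₃ θ K₀ g₀ (fun _ x => x) (fun _ u => ∀ y : SiteSeqKey F (K₀ + K), u = ⟨K, y⟩ →
          ∀ b ∈ p.2, (↑(iterBlock (lv K j) b) : Set (Site (F.P (K₀ + K)) 0)) ⊆ (y.2 j)ᶜ) K t,
          weightBK₁₃ θ hP K₀ g₀ os (fun _ x => x) K t u ≤
        δ K j ^ n K j * ∑ u ∈ classSetK₁₃ θ K₀ g₀ (fun _ x => x) K, weightBK₁₃ θ hP K₀ g₀ os (fun _ x => x) K t u) :
    RelWeightBound 1 (classSetK₁₃ θ K₀ g₀ (keyReadingId₁₃ N K₀ F θ hP g₀ os)) (weightAK₁₃ θ hP K₀ g₀ os (keyReadingId₁₃ N K₀ F θ hP g₀ os))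
      (weightBK₁₃ θ hP K₀ g₀ os (keyReadingId₁₃ N K₀ F θ hP g₀ os))
      (badClassK₁₃ θ K₀ g₀ (keyReadingId₁₃ N K₀ F θ hP g₀ os)
        (badKeyReadingOfBigComponent₁₃ N K₀ jcut (bigDialOfCard₁₃ K₀ (fun K j => n K j * (F.L ^ 4) ^ lv K j)) F θ hP g₀ os))
      (fun K => δ₀ * (1 / 2) ^ (K + 1)) :=
  relWeightBound_card_of_insideBlockEnergyLetters_geometric θ hP K₀ g₀ os (fun _ x => x) jcut n lv (fun _ _ hx => fst_eq_of_mem_classSet₁₃ θ K₀ g₀ hx) hδ0 hδ1 hD hn hlv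
    (fun K j hj => hsat_keyReadingId₁₃ θ K₀ g₀ lv hlv K j (hlvj K j hj)) hEA hEB

end Face

end YMDAG.UVSplit

end

/-! ## v1.1 ERRATUM (docstring of `relWeightBound_card_of_insideBlockEnergyLetters_id_of_eq`, «the grain at which print pays its large-field factors ([LF-II] (1.79) ∕ (1.89):
one factor per large-field cube)») — answered to ref-F g36 READ-810 NIT-1; docstring-only, every declaration above byte-identical.
The parenthetical overstates (1.79): read first-hand ([LF-II] pp. 383–386, PDF 29–32), the right side of (1.79) is a product over COMPONENTS of `Z_j`; per component print
extracts `exp(−2p₀(g_{j(Z)}))` ONCE ((1.77)–(1.78)), and the per-cube factor printed on p. 383 l. 25–26 is the ENTROPY `exp O(1)(MR_j)^{−d}|Z_j|` of the admissible-sequence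
sums — a growth, not a decay.  The print-side source of a decay PER UNIT OF SIZE is (1.85) p. 386: a NEW large-field region `Z″_{j+1,i}` enters `κ_{j+1}(Z)` with
`γ₀A₁p₀²(g_{j+1})·(d′_{j+1}(Z″) + 1)`, `d′` the shortest-tree size of the region in `LMR_{j+1}`-cube units, against the entropy `O(1)M^dR^d_{j+1}d′_{j+1}(Z)`; the improved
bound (1.89) p. 387 keeps `−κ₁d_k(X)` of it.  So an INSIDE block letter at the 𝐃-cube grain with `δ K j` of the order `exp(−γ₀A₁p₀²(g_{j+1}) + O(1)M^dR^d_{j+1})` per cube of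
tree size is the strength print's bookkeeping pays for regions CREATED at that step — for OLD regions the factor is the inductive `κ_j` of (1.80), and in every case print's
factors are ABSOLUTE (per term), not RELATIVE to the run's total: the letter of this file remains LCS-shaped, NOT PRINTED as a two-run statement, nobody's.  Nothing else changes;
no count moves. -/
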